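import Summits.QuantumFields.YangMills.Theorems.AllWindowsColdBoxBoxHighLineK3PrimeRowSumRows
import Summits.QuantumFields.YangMills.Theorems.AllWindowsColdBoxBoxHighLineRestrictionSetCum3Sup
import Summits.QuantumFields.YangMills.Theorems.AllWindowsColdBoxBoxHighLineTiltUParitySizes
import Summits.QuantumFields.YangMills.Theorems.AllWindowsColdBoxBoxHighLineSmallFieldInsideFPByName

/-!
# U5 K3′ — row RB of the hK3 ROW SUM, BY NAME (per-row `hKk` currency): the `Q`-slots against the even tilt part
# (K3′ term table of record = HOME bus 2026-08-30T01:19:30Z; planner ym-idea-2 g19 02:15:47Z «hRB ← fcl-p3»; LINE-20 U5 ⟨stmt-QuantumFields-24336⟩)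

Free-hands helper of the κ-lineage (ym-line-fcl-p3 g27).  Row RB of ✓`tiltCum3_cutSet_size_of_rows` (`…K3PrimeRowSum`) is
`|κ₃(Q_x, c_y; Uᵉ) + κ₃(L_x, Q_y; Uᵉ)|`, `Q_z := c_z − L_z`, `Uᵉ a := (tiltU a + tiltU(−a))/2`, over the cut set `D ⊆ smallField H s`, `s = β^{(1/8−θ/4)−1/2}`.
SUP on the `Q`-slot (`|c − L| ≤ 100·s³`, ✓`TiltSup.abs_chartPlaqCost_sub_linCurvSq_le`) × centred `L²` of the plaquette slot (`E₀[sfInd·(c − E₀L)²] ≤ C·L²/β²`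
✓`TiltSup.gaussAvg_sfInd_mul_sq_chartPlaqCost_sub_mean_le`, `E₀[(L − E₀L)²] ≤ C·L²/β²` ✓`EdgeChartGaussian.gaussAvg_centred_linCurvSq_sq_le`) × the 13K-U even letter
(`E₀[sfInd·(Uᵉ − b)²] ≤ C·L^m·(H⁸/β² + H¹²s⁶ + H⁸s⁸)` ✓`GaussNormalForm.gaussAvg_sfInd_mul_sq_tiltU_even_sub_le`, `β ≥ H⁴`, `s·H² ≤ c₀` by ✓`AssemblyBudget.side_budget`;
integrability on the small field by ✓`TiltSup.abs_tiltU_le`), assembled with ✓`GaussRestrict.abs_tiltCum3_muSet_zero_le_of_sup_left` (+ ✓`EdgeChartGaussian.tiltCum3_comm`):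

* ★ `K3RowSum.rowBound_RB` — `q := 1`, `K β H := 4·(100s³)·(√(2C_M)·L·β⁻¹)·(√(2C_U)·L^m·(H⁴β⁻¹ + H⁶s³ + H⁴s⁴))`; budget `β²H⁸K = C″·L^{m+1}·(H¹²s³ + H¹⁴s⁶β + H¹²s⁷β)`,
  exponent rows at `κ₃ = 1/8−θ/4`: `12θ + 3(κ₃−1/2) = 11.25θ − 1.125 < 0 ⟺ θ < 1/10` (strict exactly on the window — allowed), `14θ + 1 + 6(κ₃−1/2) = 12.5θ − 1.25 < 0 ⟺ θ < 1/10`,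
  `12θ + 1 + 7(κ₃−1/2) = 10.25θ − 1.625 < 0` ✓ (✓`budget_monomial`, `(k,j,a) = (12,3,0), (14,6,1), (12,7,1)`).

No definitions; tree only; standard axioms.  HONEST LABEL: helper-grade U5 prep (one row of hK3 by name; hK3 itself is NOT proved — hE1r, hRA remain hypotheses at this point);
U5, ⟨24336⟩, ⟨24004⟩ remain OPEN; route AllWindowsColdBox is DRAFT; no crux, rung or summit is proved; **the Yang–Mills mass gap is NOT proved by this file; no summit
is proved by a line.**
-/

set_option autoImplicit false

noncomputable section

open MeasureTheory
open Literature.Probability.LatticeModels (Site)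
open Literature.MathematicalPhysics.QuantumLattice (ZdPlaquette plaquettesTouching)
open Literature.MathematicalPhysics.QuantumFieldTheory.AxialGauge (boxEdges)
open Summit.QuantumFields.YangMills.Theorems.WeakCouplingRates (plaq12At)

namespace Summit.QuantumFields.YangMills.Theorems.AllWindowsColdBoxBoxHighLine

namespace K3RowSum

open AssemblyBudget ErrorBudget

/-- `a² + b² + c² ≤ (a + b + c)²` for nonnegative reals. -/
private theorem sq_add_sq_add_sq_le {a b c : ℝ} (ha : 0 ≤ a) (hb : 0 ≤ b) (hc : 0 ≤ c) : a ^ 2 + b ^ 2 + c ^ 2 ≤ (a + b + c) ^ 2 := by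
  nlinarith [mul_nonneg ha hb, mul_nonneg ha hc, mul_nonneg hb hc]

/-- `x ≤ x²` for `x ≥ 1`. -/
private theorem le_sq_of_one_le' {x : ℝ} (h : 1 ≤ x) : x ≤ x ^ 2 := by nlinarith

/-- ★ **Row RB (the `Q`-slots against the even tilt part `Uᵉ`) in the per-row `hKk` currency, BY NAME.** -/
theorem rowBound_RB : ∀ θ : ℝ, 0 < θ → θ < 1 / 10 → ∃ q : ℝ, ∃ K : ℝ → ℕ → ℝ,
      (∃ β₀ : ℝ, 1 ≤ β₀ ∧ ∀ β : ℝ, β₀ ≤ β → ∀ H : ℕ, 1 ≤ H → β ^ θ ≤ (H : ℝ) → (H : ℝ) ≤ β ^ θ + 1 →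
        ∀ D : Set (LandauFree H → E3), MeasurableSet D → D ⊆ smallField H (β ^ ((1 / 8 - θ / 4) - 1 / 2)) → (∀ a, -a ∈ D ↔ a ∈ D) →
        gaussAvg β H (fun a => 1 - D.indicator (fun _ => (1 : ℝ)) a) ≤ β ^ (-q) →
        gaussAvg β H (fun a => 1 - D.indicator (fun _ => (1 : ℝ)) a) ≤ 1 / 2 → (∀ a ∈ D, |tiltU β H a| ≤ 2) → ∀ x y : Site 4,
        let μD : Measure (LandauFree H → E3) := ((volume : Measure (LandauFree H → E3)).restrict D).withDensity fun a => ENNReal.ofReal (gaussWeight β H a)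
        let Ue : (LandauFree H → E3) → ℝ := fun a => (tiltU β H a + tiltU β H (-a)) / 2
        |Tilt.tiltCum3 μD Ue 0 (fun a => chartPlaqCost H x 1 2 a - linCurvSq H (plaq12At x) a) (chartPlaqCost H y 1 2) +
            Tilt.tiltCum3 μD Ue 0 (linCurvSq H (plaq12At x)) (fun a => chartPlaqCost H y 1 2 a - linCurvSq H (plaq12At y) a)| ≤ K β H) ∧
      (∀ ε : ℝ, 0 < ε → ∃ β₀ : ℝ, 1 ≤ β₀ ∧ ∀ β : ℝ, β₀ ≤ β → ∀ H : ℕ, 1 ≤ H → (H : ℝ) ≤ β ^ θ + 1 → β ^ 2 * (H : ℝ) ^ 8 * K β H ≤ ε) := by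
  intro θ hθ hθ'
  obtain ⟨Cc, hCc0, hC⟩ := TiltSup.gaussAvg_sfInd_mul_sq_chartPlaqCost_sub_mean_le
  obtain ⟨CLv, hCLv0, hLv⟩ := EdgeChartGaussian.gaussAvg_centred_linCurvSq_sq_le
  obtain ⟨CU, cU, m, hcU, hUe⟩ := GaussNormalForm.gaussAvg_sfInd_mul_sq_tiltU_even_sub_le
  obtain ⟨CT, cT, mT, hcT, hT⟩ := TiltSup.abs_tiltU_le
  obtain ⟨b₀, hb₀, hside⟩ := side_budget (κ₃ := 1 / 8 - θ / 4) (c := min cU cT) hθ (by linarith) (by linarith) (lt_min hcU hcT) 0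
  set CM : ℝ := max Cc CLv with hCM
  have hCM0 : 0 ≤ CM := hCc0.trans (le_max_left _ _)
  set CU' : ℝ := max CU 0 with hCU'
  have hCU'0 : 0 ≤ CU' := le_max_right _ _
  refine ⟨1, fun β H => 4 * (100 * (β ^ ((1 / 8 - θ / 4) - 1 / 2)) ^ 3) * (Real.sqrt (2 * CM) * (1 + Real.log H) * β⁻¹) *
      (Real.sqrt (2 * CU') * (1 + Real.log H) ^ m *
        ((H : ℝ) ^ 4 * β⁻¹ + (H : ℝ) ^ 6 * (β ^ ((1 / 8 - θ / 4) - 1 / 2)) ^ 3 + (H : ℝ) ^ 4 * (β ^ ((1 / 8 - θ / 4) - 1 / 2)) ^ 4)),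
    ⟨max b₀ 2, (show (1 : ℝ) ≤ 2 by norm_num).trans (le_max_right _ _), ?_⟩, ?_⟩
  · intro β hβ H hH hHl hHu D hDm hDs hsym hco hco2 hU x y μD Ue
    have hb : b₀ ≤ β := (le_max_left _ _).trans hβ
    have h2 : (2 : ℝ) ≤ β := (le_max_right _ _).trans hβ
    have hβ0 : 0 < β := by linarith
    have hβ1 : 1 ≤ β := by linarith
    have hτ2 : β ^ (-(1 : ℝ)) ≤ 1 / 2 := by
      rw [Real.rpow_neg_one]
      have h := inv_anti₀ (by norm_num : (0 : ℝ) < 2) h2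
      norm_num at h ⊢
      exact h
    obtain ⟨hH4, hsH, -, -, hs1⟩ := hside β hb H hH hHl hHu
    set s : ℝ := β ^ ((1 / 8 - θ / 4) - 1 / 2) with hsdef
    have hs0 : 0 ≤ s := Real.rpow_nonneg hβ0.le _
    have hH1 : (1 : ℝ) ≤ H := by exact_mod_cast hH
    set L : ℝ := 1 + Real.log H with hL
    have hL1 : 1 ≤ L := by have := Real.log_nonneg hH1; rw [hL]; linarith
    have hL0 : 0 ≤ L := zero_le_one.trans hL1
    -- the 13K-U even letter and the small-field sup of `tiltU`
    obtain ⟨b, hb13⟩ := hUe H hH β hH4 s hs0 hs1 (hsH.trans (min_le_left _ _))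
    have hTs := hT H hH β s hs0 hs1 (hsH.trans (min_le_right _ _))
    set T : ℝ := CT * (1 + Real.log H) ^ mT * (|β| * (H : ℝ) ^ 4 * s ^ 3 + (H : ℝ) ^ 6 * s ^ 2) with hTdef
    have hUe_def : ∀ a, Ue a = (tiltU β H a + tiltU β H (-a)) / 2 := fun a => rfl
    -- the sup on the `Q`-slot
    have hS0 : 0 ≤ 100 * s ^ 3 := by positivity
    have supQ : ∀ z : Site 4, ∀ a ∈ D, |chartPlaqCost H z 1 2 a - linCurvSq H (plaq12At z) a| ≤ 100 * s ^ 3 := fun z a ha =>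
      TiltSup.abs_chartPlaqCost_sub_linCurvSq_le hs0 hs1 (hDs ha) z 1 2
    -- a common crude bound on `D` and measurability
    have hs2 : s ^ 2 ≤ 1 := pow_le_one₀ hs0 hs1
    have hs3 : s ^ 3 ≤ 1 := pow_le_one₀ hs0 hs1
    have hBall0 : (0 : ℝ) ≤ 250 := by norm_num
    have bQ : ∀ z : Site 4, ∀ a ∈ D, |chartPlaqCost H z 1 2 a - linCurvSq H (plaq12At z) a| ≤ 250 := fun z a ha =>
      (supQ z a ha).trans (by linarith only [hs3])
    have bc : ∀ z : Site 4, ∀ a ∈ D, |chartPlaqCost H z 1 2 a| ≤ 250 := fun z a ha =>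
      (TiltSup.abs_chartPlaqCost_le hs0 hs1 (hDs ha) z 1 2).trans (by linarith only [hs2])
    have bL : ∀ z : Site 4, ∀ a ∈ D, |linCurvSq H (plaq12At z) a| ≤ 250 := fun z a ha => by
      have h1 : linCurvSq H (plaq12At z) a ≤ 16 * s ^ 2 := TiltSup.linCurvSq_le hs0 (hDs ha) z 1 2
      have h0 : 0 ≤ linCurvSq H (plaq12At z) a := Finset.sum_nonneg fun c _ => sq_nonneg _
      rw [abs_of_nonneg h0]; linarith only [h1, hs2]
    have bUe : ∀ a ∈ D, |Ue a| ≤ 250 := fun a ha => by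
      rw [hUe_def, abs_div, abs_two]
      linarith only [abs_add_le (tiltU β H a) (tiltU β H (-a)), hU a ha, hU (-a) ((hsym a).2 ha)]
    have mU : Measurable (tiltU β H) := GaussNormalForm.measurable_tiltU β H
    have mUe : Measurable Ue := (mU.add (mU.comp measurable_neg)).div_const 2
    have mc : ∀ z : Site 4, Measurable (chartPlaqCost H z 1 2) := fun z => EdgeChartGaussian.measurable_chartPlaqCost H z 1 2
    have mL : ∀ z : Site 4, Measurable (linCurvSq H (plaq12At z)) := fun z => EdgeChartGaussian.measurable_linCurvSq H (plaq12At z)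
    have mQ : ∀ z : Site 4, Measurable fun a => chartPlaqCost H z 1 2 a - linCurvSq H (plaq12At z) a := fun z => (mc z).sub (mL z)
    -- the two pieces (sup on the `Q`-slot; the second after the slot swap)
    set mx : ℝ := gaussAvg β H (linCurvSq H (plaq12At x)) with hmx
    set my : ℝ := gaussAvg β H (linCurvSq H (plaq12At y)) with hmy
    have t1 := GaussRestrict.abs_tiltCum3_muSet_zero_le_of_sup_left hβ0 hDm hco hτ2 Ue hBall0 hS0 (mQ x) (mc y) mUe (bQ x) (bc y) bUe (supQ x) my b
    have t2 := GaussRestrict.abs_tiltCum3_muSet_zero_le_of_sup_left hβ0 hDm hco hτ2 Ue hBall0 hS0 (mQ y) (mL x) mUe (bQ y) (bL x) bUe (supQ y) mx b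
    rw [← EdgeChartGaussian.tiltCum3_comm] at t2
    -- ### Gaussian letters
    have ind0 : ∀ {G : (LandauFree H → E3) → ℝ}, (∀ a, 0 ≤ G a) → ∀ a, 0 ≤ D.indicator (fun _ => (1 : ℝ)) a * G a :=
      fun hG a => mul_nonneg (GaussRestrict.indicator_one_nonneg_le_one D a).1 (hG a)
    have ind_le : ∀ {G : (LandauFree H → E3) → ℝ}, (∀ a, 0 ≤ G a) → ∀ a, D.indicator (fun _ => (1 : ℝ)) a * G a ≤ sfInd H s a * G a := by
      intro G hG a
      refine mul_le_mul_of_nonneg_right ?_ (hG a)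
      by_cases ha : a ∈ D
      · rw [Set.indicator_of_mem ha, TiltSup.sfInd_of_mem (hDs ha)]
      · rw [Set.indicator_of_notMem ha]; exact (TiltSup.sfInd_nonneg_le_one (H := H) s a).1
    have ind_le1 : ∀ {G : (LandauFree H → E3) → ℝ}, (∀ a, 0 ≤ G a) → ∀ a, D.indicator (fun _ => (1 : ℝ)) a * G a ≤ G a := fun hG a => by
      calc D.indicator (fun _ => (1 : ℝ)) a * _ ≤ 1 * _ := mul_le_mul_of_nonneg_right (GaussRestrict.indicator_one_nonneg_le_one D a).2 (hG a)
        _ = _ := one_mul _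
    -- (c) the plaquette slot, centred at `E₀ L`
    have ic : ∀ z : Site 4, Integrable fun a => sfInd H s a * (chartPlaqCost H z 1 2 a - gaussAvg β H (linCurvSq H (plaq12At z))) ^ 2 * gaussWeight β H a :=
      fun z => Tilt.integrable_sfInd_mul H hβ0 s (((mc z).sub measurable_const).pow_const 2) (sq_nonneg (4 + |gaussAvg β H (linCurvSq H (plaq12At z))|))
        fun a _ => by
          rw [abs_pow]
          exact pow_le_pow_left₀ (abs_nonneg _) ((abs_sub _ _).trans (add_le_add (TiltSup.abs_chartPlaqCost_le_four z 1 2 a) le_rfl)) 2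
    have gc : Real.sqrt (2 * gaussAvg β H (fun a => D.indicator (fun _ => (1 : ℝ)) a * (chartPlaqCost H y 1 2 a - my) ^ 2)) ≤ Real.sqrt (2 * CM) * L * β⁻¹ := by
      have h1 : gaussAvg β H (fun a => D.indicator (fun _ => (1 : ℝ)) a * (chartPlaqCost H y 1 2 a - my) ^ 2) ≤ CM * L ^ 2 / β ^ 2 :=
        ((EdgeChartGaussian.gaussAvg_mono_of_nonneg H hβ0 (ind0 fun a => sq_nonneg _) (ind_le fun a => sq_nonneg _) (ic y)).trans (hC H hH β hβ1 s y)).trans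
          (div_le_div_of_nonneg_right (mul_le_mul_of_nonneg_right (le_max_left _ _) (sq_nonneg _)) (sq_nonneg _))
      have hM : 0 ≤ Real.sqrt (2 * CM) * L * β⁻¹ := by positivity
      have hsq : (Real.sqrt (2 * CM) * L * β⁻¹) ^ 2 = 2 * (CM * L ^ 2 / β ^ 2) := by
        rw [mul_pow, mul_pow, Real.sq_sqrt (by positivity), inv_pow, div_eq_mul_inv]; ring
      calc _ ≤ Real.sqrt ((Real.sqrt (2 * CM) * L * β⁻¹) ^ 2) := Real.sqrt_le_sqrt (by rw [hsq]; linarith only [h1])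
        _ = _ := Real.sqrt_sq hM
    -- (L) the quadratic slot, centred at `E₀ L`
    have iL : Integrable fun a => (linCurvSq H (plaq12At x) a - mx) ^ 2 * gaussWeight β H a :=
      EdgeChartGaussian.integrable_polyCert_mul_gaussWeight H hβ0 (EdgeChartGaussian.polyCert_pow
        (EdgeChartGaussian.polyCert_sub (EdgeChartGaussian.polyCert_linCurvSq H (plaq12At x)) (EdgeChartGaussian.polyCert_const mx 2)) 2)
    have gL : Real.sqrt (2 * gaussAvg β H (fun a => D.indicator (fun _ => (1 : ℝ)) a * (linCurvSq H (plaq12At x) a - mx) ^ 2)) ≤ Real.sqrt (2 * CM) * L * β⁻¹ := by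
      have h1 : gaussAvg β H (fun a => D.indicator (fun _ => (1 : ℝ)) a * (linCurvSq H (plaq12At x) a - mx) ^ 2) ≤ CM * L ^ 2 / β ^ 2 :=
        ((EdgeChartGaussian.gaussAvg_mono_of_nonneg H hβ0 (ind0 fun a => sq_nonneg _) (ind_le1 fun a => sq_nonneg _) iL).trans (hLv H hH β hβ0 (plaq12At x))).trans
          (div_le_div_of_nonneg_right (mul_le_mul_of_nonneg_right (le_max_right _ _) (sq_nonneg _)) (sq_nonneg _))
      have hM : 0 ≤ Real.sqrt (2 * CM) * L * β⁻¹ := by positivity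
      have hsq : (Real.sqrt (2 * CM) * L * β⁻¹) ^ 2 = 2 * (CM * L ^ 2 / β ^ 2) := by
        rw [mul_pow, mul_pow, Real.sq_sqrt (by positivity), inv_pow, div_eq_mul_inv]; ring
      calc _ ≤ Real.sqrt ((Real.sqrt (2 * CM) * L * β⁻¹) ^ 2) := Real.sqrt_le_sqrt (by rw [hsq]; linarith only [h1])
        _ = _ := Real.sqrt_sq hM
    -- (U) the even tilt slot
    have bUes : ∀ a ∈ smallField H s, |Ue a| ≤ T := fun a ha => by
      have h1 := hTs a ha
      have h2' := hTs (-a) ((EdgeChartGaussian.neg_mem_smallField_iff s a).2 ha)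
      rw [hUe_def, abs_div, abs_two]; linarith only [abs_add_le (tiltU β H a) (tiltU β H (-a)), h1, h2']
    have iU : Integrable fun a => sfInd H s a * (Ue a - b) ^ 2 * gaussWeight β H a :=
      Tilt.integrable_sfInd_mul H hβ0 s ((mUe.sub measurable_const).pow_const 2) (sq_nonneg (T + |b|)) fun a ha => by
        rw [abs_pow]; exact pow_le_pow_left₀ (abs_nonneg _) ((abs_sub _ _).trans (add_le_add (bUes a ha) le_rfl)) 2
    set Y : ℝ := (H : ℝ) ^ 4 * β⁻¹ + (H : ℝ) ^ 6 * s ^ 3 + (H : ℝ) ^ 4 * s ^ 4 with hY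
    have hY0 : 0 ≤ Y := by positivity
    have gU : Real.sqrt (2 * gaussAvg β H (fun a => D.indicator (fun _ => (1 : ℝ)) a * (Ue a - b) ^ 2)) ≤ Real.sqrt (2 * CU') * L ^ m * Y := by
      have h1 : gaussAvg β H (fun a => D.indicator (fun _ => (1 : ℝ)) a * (Ue a - b) ^ 2) ≤
          CU' * L ^ m * ((H : ℝ) ^ 8 / β ^ 2 + (H : ℝ) ^ 12 * s ^ 6 + (H : ℝ) ^ 8 * s ^ 8) :=
        ((EdgeChartGaussian.gaussAvg_mono_of_nonneg H hβ0 (ind0 fun a => sq_nonneg _) (ind_le fun a => sq_nonneg _) iU).trans hb13).trans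
          (mul_le_mul_of_nonneg_right (mul_le_mul_of_nonneg_right (le_max_left _ _) (by positivity)) (by positivity))
      have hX8Y : (H : ℝ) ^ 8 / β ^ 2 + (H : ℝ) ^ 12 * s ^ 6 + (H : ℝ) ^ 8 * s ^ 8 ≤ Y ^ 2 := by
        have e : (H : ℝ) ^ 8 / β ^ 2 = ((H : ℝ) ^ 4 * β⁻¹) ^ 2 := by rw [mul_pow, inv_pow, div_eq_mul_inv]; ring
        have e2 : (H : ℝ) ^ 12 * s ^ 6 = ((H : ℝ) ^ 6 * s ^ 3) ^ 2 := by ring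
        have e3 : (H : ℝ) ^ 8 * s ^ 8 = ((H : ℝ) ^ 4 * s ^ 4) ^ 2 := by ring
        have ha : 0 ≤ (H : ℝ) ^ 4 * β⁻¹ := by positivity
        have hb' : 0 ≤ (H : ℝ) ^ 6 * s ^ 3 := by positivity
        have hc' : 0 ≤ (H : ℝ) ^ 4 * s ^ 4 := by positivity
        rw [e, e2, e3, hY]
        exact sq_add_sq_add_sq_le ha hb' hc'
      have hLm : L ^ m ≤ (L ^ m) ^ 2 := le_sq_of_one_le' (one_le_pow₀ hL1)
      have h2 : 2 * gaussAvg β H (fun a => D.indicator (fun _ => (1 : ℝ)) a * (Ue a - b) ^ 2) ≤ (Real.sqrt (2 * CU') * L ^ m * Y) ^ 2 := by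
        have hsq : (Real.sqrt (2 * CU') * L ^ m * Y) ^ 2 = 2 * CU' * (L ^ m) ^ 2 * Y ^ 2 := by
          rw [mul_pow, mul_pow, Real.sq_sqrt (by positivity)]
        rw [hsq]
        have h3 : CU' * L ^ m * ((H : ℝ) ^ 8 / β ^ 2 + (H : ℝ) ^ 12 * s ^ 6 + (H : ℝ) ^ 8 * s ^ 8) ≤ CU' * (L ^ m) ^ 2 * Y ^ 2 :=
          mul_le_mul (mul_le_mul_of_nonneg_left hLm hCU'0) hX8Y (by positivity) (by positivity)
        linarith only [h1, h3]
      have hM : 0 ≤ Real.sqrt (2 * CU') * L ^ m * Y := by positivity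
      calc _ ≤ Real.sqrt ((Real.sqrt (2 * CU') * L ^ m * Y) ^ 2) := Real.sqrt_le_sqrt h2
        _ = _ := Real.sqrt_sq hM
    -- ### assemble
    have hMc : 0 ≤ Real.sqrt (2 * CM) * L * β⁻¹ := by positivity
    have piece : ∀ {t u v : ℝ}, t ≤ 2 * (100 * s ^ 3) * u * v → 0 ≤ u → 0 ≤ v → u ≤ Real.sqrt (2 * CM) * L * β⁻¹ → v ≤ Real.sqrt (2 * CU') * L ^ m * Y →
        t ≤ 2 * (100 * s ^ 3) * (Real.sqrt (2 * CM) * L * β⁻¹) * (Real.sqrt (2 * CU') * L ^ m * Y) := by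
      intro t u v ht hu hv hu' hv'
      refine ht.trans ?_
      have h1 : 2 * (100 * s ^ 3) * u * v ≤ 2 * (100 * s ^ 3) * (Real.sqrt (2 * CM) * L * β⁻¹) * v :=
        mul_le_mul_of_nonneg_right (mul_le_mul_of_nonneg_left hu' (by positivity)) hv
      exact h1.trans (mul_le_mul_of_nonneg_left hv' (by positivity))
    have e1 := piece t1 (Real.sqrt_nonneg _) (Real.sqrt_nonneg _) gc gU
    have e2 := piece t2 (Real.sqrt_nonneg _) (Real.sqrt_nonneg _) gL gU
    refine (abs_add_le _ _).trans ?_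
    have hsum := add_le_add e1 e2
    refine hsum.trans (le_of_eq ?_)
    dsimp only
    rw [hY, hsdef, hL]; ring
  · intro ε hε
    have hε' : 0 < ε / 3 := by positivity
    have hc1 : (12 : ℕ) * θ + (0 : ℝ) < (3 : ℕ) * (1 / 2 - (1 / 8 - θ / 4)) := by push_cast; linarith
    have hc2 : (14 : ℕ) * θ + (1 : ℝ) < (6 : ℕ) * (1 / 2 - (1 / 8 - θ / 4)) := by push_cast; linarith
    have hc3 : (12 : ℕ) * θ + (1 : ℝ) < (7 : ℕ) * (1 / 2 - (1 / 8 - θ / 4)) := by push_cast; linarith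
    set C'' : ℝ := 4 * 100 * Real.sqrt (2 * CM) * Real.sqrt (2 * CU') with hC''
    obtain h₁ := budget_monomial (k := 12) (j := 3) (a := 0) (κ₃ := 1 / 8 - θ / 4) hθ.le hc1 hε' C'' (m + 1)
    obtain h₂ := budget_monomial (k := 14) (j := 6) (a := 1) (κ₃ := 1 / 8 - θ / 4) hθ.le hc2 hε' C'' (m + 1)
    obtain h₃ := budget_monomial (k := 12) (j := 7) (a := 1) (κ₃ := 1 / 8 - θ / 4) hθ.le hc3 hε' C'' (m + 1)
    obtain ⟨β₀, hβ₀, hall⟩ := exists_forall_and h₁ (exists_forall_and h₂ h₃)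
    refine ⟨β₀, hβ₀, fun β hβ H hH hHu => ?_⟩
    obtain ⟨e₁, e₂, e₃⟩ := hall β hβ H
    replace e₁ := e₁ hH hHu
    replace e₂ := e₂ hH hHu
    replace e₃ := e₃ hH hHu
    have hβ0 : 0 < β := by linarith
    have hb2 : (β : ℝ) ^ 2 = β ^ (2 : ℝ) := by rw [← Real.rpow_natCast]; norm_num
    have hm0 : β ^ (0 : ℝ) = β ^ (2 : ℝ) * β ^ (-(1 : ℝ)) * β ^ (-(1 : ℝ)) := by
      rw [← Real.rpow_add hβ0, ← Real.rpow_add hβ0]; norm_num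
    have hm1 : β ^ (1 : ℝ) = β ^ (2 : ℝ) * β ^ (-(1 : ℝ)) := by
      rw [← Real.rpow_add hβ0]; norm_num
    set s : ℝ := β ^ ((1 / 8 - θ / 4) - 1 / 2) with hs
    have hid : β ^ 2 * (H : ℝ) ^ 8 * (4 * (100 * s ^ 3) * (Real.sqrt (2 * CM) * (1 + Real.log H) * β⁻¹) *
        (Real.sqrt (2 * CU') * (1 + Real.log H) ^ m * ((H : ℝ) ^ 4 * β⁻¹ + (H : ℝ) ^ 6 * s ^ 3 + (H : ℝ) ^ 4 * s ^ 4))) =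
        C'' * (H : ℝ) ^ 12 * (1 + Real.log H) ^ (m + 1) * s ^ 3 * β ^ (0 : ℝ) +
          (C'' * (H : ℝ) ^ 14 * (1 + Real.log H) ^ (m + 1) * s ^ 6 * β ^ (1 : ℝ) +
            C'' * (H : ℝ) ^ 12 * (1 + Real.log H) ^ (m + 1) * s ^ 7 * β ^ (1 : ℝ)) := by
      rw [hb2, ← Real.rpow_neg_one, hm0, hm1, hC'']; ring
    rw [hid]
    linarith only [e₁, e₂, e₃]

end K3RowSum

end Summit.QuantumFields.YangMills.Theorems.AllWindowsColdBoxBoxHighLine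

end
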